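import Literature.Geometry.Lorentzian.KlainermanSzeftel2021.SupToFluxExponents
import Literature.Geometry.Lorentzian.KlainermanSzeftel2021.Bootstrap

/-!
# Klainerman–Szeftel Lemma 9.4.13, the `B`-terms of `ℜ_{k_small−1}`: the MIXED count (an `ε₀`-size pointwise rate
below critical combined with a size-`ε` rate above critical), its `u`-integration, the mixing window, and what the
continuation argument tolerates

CITATION HEADER (lean-in-tree rule 2026-08-18).  This module is EXPONENT BOOKKEEPING (elementary real analysis, kernel-proved,
tagged `[folklore]`) about displays PRINTED in

* S. Klainerman, J. Szeftel, *Kerr stability for small angular momentum*, arXiv:2104.11857 (v1, 2021; TeX source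
  `Main-Kerr-arxiv.tex` held by the audit cell; refereed version Pure Appl. Math. Q. 19 (2023), no. 3, 791–1678,
  bib key `KlainermanSzeftel2021` / `KlainermanSzeftel2023`) — cited below as KS with TeX line numbers;
* E. Giorgi, S. Klainerman, J. Szeftel, *Wave equations estimates and the nonlinear stability of slowly rotating Kerr
  black holes*, arXiv:2205.14808 (TeX `FinalKerrarxivversion.tex`, bib key `GiorgiKlainermanSzeftel2022`; refereed
  Pure Appl. Math. Q. 20 (2024), no. 7, 2865–3849, bib key `GiorgiKlainermanSzeftel2024`, read in the authors' version
  HAL hal-05348127 — "HAL p. N" is a page of that text, not a journal page; REFEREE #19 L-6) — cited as GKS; the one GKS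
  display used is the VALUE `δ_extra = (3δ_dec − 2δ)/2` of Theorem M1, ch. 11 Step 7, TeX l.22524 = HAL p.532 (PDF p.533).

STATUS OF THE SOURCES.  Both are refereed publications; within the audit cell `pub-kerr` they are UNDER ADJUDICATION: nothing in
them is cited here as a fact.  Every printed weight, rate and constant relation enters as a real PARAMETER or an explicit
hypothesis; the theorems below are statements about model radial/temporal integrals with those parameters.  The module
asserts nothing about the papers' analysis (frame passages, commutations, the nonlinear structure); it re-proves no estimate.

WHAT IS COUNTED, AND WHY (cell files GAPS.md K20b′/K20b″ (f3-g4), lead block 9 = K20b‴ (carver-g5), referee note V8 =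
REFEREE.md #18; tree `SupToFluxExponents`).  KS Lemma 9.4.13, (9.4.22), l.24355–24360, asserts `𝔖_{k_small−1} + ℜ_{k_small−1} ≲ ε₀`
for the global PT norms of §9.4.1; the `B`-part of `^(ext)ℜ_k²` is `∫_{ℳext} r^{3+δ_B}|𝔡^{≤k}B|²` (l.23912–23915; 4-volume `≍ r² dr du`).
Its proof ends (l.24420–24425, verbatim) "The weights in `r`, `u` and `u̲` are enough to take care of the spacetime integrations
in the global norms … and we finally obtain `𝔖_{k_small−1} + ℜ_{k_small−1} ≲ ε₀`" — no computation is printed.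

* SIZE `ε` IS OUTRIGHT (referee V8, lead (0)): the bootstrap assumption BA-PT = (9.4.20), l.24317–24319, `𝔖_k + ℜ_k ≤ ε`,
  `k ≤ k_large + 7`, gives `ℜ_{k_small−1} ≤ ε` with NO integration; nothing in the paper diverges.  The content of (9.4.22)
  is the IMPROVEMENT `ε → ε₀`, consumed (c1) as the base of the §9.4.4 iteration (Remark 9.4.14, l.24467–24473) and (c2) in
  the §9.4.8 display `L_*(k_small−1) ≲ ε₀` (l.24684–24687).  Every "unbounded" below is a statement about what given
  POINTWISE inputs yield for that improvement, never about the paper's norms.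
* THE TWO POINTWISE INPUTS MIXED HERE.  (I₀) `ε₀`-size, rate below critical: KS Proposition l.16631–16637, "on `ℳext`,
  `|𝔡^{≤k_*−6}B| ≲ ε₀ r^{−3−δ′} u^{−1/2−δ_dec}`" (`k_* = k_small + 60` in that chapter, footnote l.15443 — ample for `k_small − 1`;
  `δ′` as in `SupToFluxExponents.deltaPrime`; stated for the bootstrap spacetime —
  its availability on Theorem M7's extension is NOT printed: Thm M7, l.6791–6800, exports `𝔑^{(Dec)}_{k_small}` only, cell
  pattern K-M7).  In the weighted integrand this is `ε₀² r^{−1+μ} u^{−1−2δ_dec} dr du`, `μ := δ_B − 2δ′ = −margin` (tree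
  `marginB_improved`; `μ > (3/2)δ_dec + δ > 0` at GKS's `δ_extra`, tree `marginB_GKS_neg`).  (I_ε) size `ε`, rate ABOVE critical:
  the bootstrap assumption BA-B, l.6353–6356, through `^(ext)𝔅_k ∋ sup_{ℳext} r^{7/2+δ_B/2}|𝔡^{≤k}B|`, l.5811–5815 (`k ≤ k_large`,
  NO `u`-weight) — a NAMED UNPRINTED HYPOTHESIS of variant V-BA, on a par with (I₀) (REFEREE #19 N-7): ch. 9 assumes ONLY BA-PT
  (the string `BA-B` does not occur in `Main-Kerr-arxiv.tex` after l.9567), Theorem M7's extension is not a priori in `ℵ(u_*′)` (that is Theorem M8's CONCLUSION,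
  l.6801–6807), and BA-PT + trace gives only the margin-0 rate `3 + δ_B/2` (`marginAB_critical`); the frame passage of
  l.24410–24413 concerns BA-PT, not BA-B.  Weighted integrand: `ε² r^{−2} dr du` (margin exactly `1`, `marginAB_bounded`).
  The extremal profile below both inputs is their pointwise minimum, `mixedProfile`.
* THE COUNT (kernel, §§1–2).  Per unit `u`: for EVERY profile below both inputs the radial integral over `[r₀, R]` is
  `≤ e₁ρ^μ/μ + e₂ρ^{−m}/m` for every `ρ > 0` (`integral_le_of_split`), `= e₁ρ_c^μ(1/μ + 1/m)` at the crossover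
  (`integral_le_at_crossing`), and the extremal profile attains `≥ e₁ρ_c^μ/2` as soon as `2r₀ ≤ ρ_c ≤ R`
  (`integral_ge_at_crossing`): two pointwise inputs give EXACTLY the crossover value, `e₁^{m/(μ+m)} e₂^{μ/(μ+m)}` up to
  constants (`value_crossover`).  With `e₁ = ε₀²u^{−1−2δ_X}`, `e₂ = ε₁²` the value is `ε₀²(ε₁²/ε₀²)^{μ/(μ+m)} · u^{−1−ν}`,
  `ν = (2mδ_X − μ)/(μ+m)` (`value_u`, `uExponent_eq`), and the `u`-integral over `[1, U]` is bounded uniformly in `U` iff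
  `ν > 0` iff `μ < 2mδ_X` (`uMargin_pos_iff`, `uIntegral_bounded`, `uIntegral_unbounded`, `uIntegral_critical`).
* THE KS INSTANCE (§3): `m = 1`, `δ_X = δ_dec`, `μ = δ_B + δ_dec − δ_extra` (`mu_eq`): the MIXING WINDOW is
  `2δ_dec < δ_B < δ_dec + δ_extra` (`mixingWindow_iff`; lower bound = KS (3.4.4), l.6076–6080) — nonempty iff `δ_extra > δ_dec`
  (`mixingWindow_nonempty_iff`), which KS quotes from Theorem M1 (l.6672) and which at GKS's value `(3δ_dec − 2δ)/2` reads
  `δ < δ_dec/2` strictly; the window is then `(2δ_dec, (5/2)δ_dec − δ)` (`mixingWindow_GKS`), strictly inside the window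
  `(2δ_dec, 2δ_extra) = (2δ_dec, 3δ_dec − 2δ)` in which Theorem M1's rate closes the `A`-part (tree `marginA_M1`, lead (6));
  whether the printed `δ_B` lies in it is NOT decided by (3.4.4), which prints only the lower bound (`mixingWindow_undecided`:
  admissible parameter points on both sides).  Inside the window the `B`-part of `ℜ²_{k_small−1}` is `≲ ε₀^{2−2κ}`,
  `κ = μ/(3(1+μ)) ∈ (0, 1/3)` (`scale_identity`, `kappa_pos`, `kappa_lt_third`), UNIFORMLY in the bootstrap time — never `ε₀²`
  (`κ > 0`); outside it the two inputs give no `u_*`-uniform improvement over BA-PT's `ε` at all (`uIntegral_unbounded`).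
  This CORRECTS two cell statements: K20b″'s "growing in the bootstrap time" (true of input (I₀) ALONE, not of the norm,
  V8), and lead block 9 (4)'s "signs unchanged under `marginB_GKS_neg`" for the `u`-exponent at the improved rate
  (`marginB_GKS_neg` gives `μ > (3/2)δ_dec + δ`, which does not decide `μ ≶ 2δ_dec`).
* WHAT THE CONTINUATION ARGUMENT TOLERATES (§4).  If the iteration base is only `𝔖_{k_small−1} + ℜ_{k_small−1} ≤ ε₁ := Cε₀^{1−κ}`,
  the §9.4.4–9.4.8 iteration is homogeneous in its size parameter: `IterationClosure.thm9410_explicit` is stated for an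
  arbitrary record `I : Ch9Iteration` and, read with `I.ε0 := ε₁`, yields Theorem 9.4.10 / M8 as `𝔖_k + ℜ_k ≤ finalConst · ε₁`,
  `k ≤ k_large + 7`, with the SAME universal `finalConst` — PROVIDED its leaves are fed at scale `ε₁` (for Cor 9.4.21 /
  Props 9.4.17–9.4.20 this is a re-reading of their proofs with `ε₁` in the additive slot, formally NOT implied by the
  `ε₀`-statements since the iteration assumption (9.4.33) enters them as a hypothesis; unprinted, routine).  Theorem M8 at
  `C·ε₀^{1−κ}` still re-enters the bootstrap set `ℵ(u_*′)` because `1 − κ > 2/3`: `smallEps_of_weakM8` produces the cell's typed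
  smallness hypothesis `Bootstrap.SmallEps` (consumed verbatim by `Bootstrap.Uset_not_bddAbove`) for the constants record
  with `cM8 := C ε₀^{−κ}`, for `ε₀` below two explicit thresholds.  COST: the Main Theorem's conclusion (3.4.8), l.6217–6220,
  clause `𝔑^{(Sup)}_{k_large} ≲ ε₀`, weakens to `≲ ε₀^{1−κ}`; the decay clause `𝔑^{(Dec)}_{k_small} ≲ ε₀` (from Thm M7) and
  the final-parameter clauses are untouched.
* CENSUS TIERS for the `B`-part of (9.4.22) (precise gap, class E, priced; NO error is claimed): (a) from print alone:
  `≤ ε` (BA-PT), which does NOT initialise the iteration at `ε₀` (running it from `ε` returns M8 at `finalConst·ε`, not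
  `≤ ε`); (b) variant V-BA = inputs (I₀)+(I_ε) on the extension (BOTH named unprinted hypotheses) + the ordering
  `δ_B < δ_dec + δ_extra`: base and M8 at `ε₀^{1−κ}`, continuation closes, (3.4.8) top-order clause weakened — every piece
  unprinted but plausible; (c) `ε₀` as
  printed: needs an `ε₀`-size pointwise rate `> 3 + δ_B/2` (margin `> 0`, `marginAB_critical`) with `u^{−1/2−δ_X}`,
  `δ_B < 2δ_X`, for `𝔡^{≤k_small−1}B` on `ℳext` of the extension — NOT located in KS/GKS (lead block 9 (6): outward Bianchi
  transport of `r⁴B` with Theorem M1, window `2δ_dec < δ_B < 2δ_extra`), or an integrated estimate.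
Written by the audit cell `pub-kerr` (literature-typer lineage f3) for GAPS.md K20b‴/V8 and LEMMAS.md node KS9.4.13-sup /
leaf KS9.4.13-Brate.  Nothing here is Final-State-Conjecture progress.
-/

open Real Set MeasureTheory intervalIntegral Filter

noncomputable section

namespace Literature.Geometry.Lorentzian.KlainermanSzeftel2021.MixedRateCount

open SupToFluxExponents

/-! ## §1 Two pointwise inputs, one radial integral: the crossover value is attained -/

/-- The extremal weighted radial profile below two pointwise inputs: an amplitude-`e₁` input of margin `−μ < 0`
(integrand `e₁ x^{−1+μ}`) and an amplitude-`e₂` input of margin `m > 0` (integrand `e₂ x^{−1−m}`); every profile compatible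
with both inputs lies below their pointwise minimum.  (Margins as in `SupToFluxExponents.margin`/`exponent_eq`.)  [folklore] -/
def mixedProfile (e₁ e₂ μ m : ℝ) (x : ℝ) : ℝ := (e₁ * x ^ (-1 + μ)) ⊓ (e₂ * x ^ (-1 - m))

/-- [folklore] -/
theorem mixedProfile_le_left (e₁ e₂ μ m x : ℝ) : mixedProfile e₁ e₂ μ m x ≤ e₁ * x ^ (-1 + μ) := inf_le_left

/-- [folklore] -/
theorem mixedProfile_le_right (e₁ e₂ μ m x : ℝ) : mixedProfile e₁ e₂ μ m x ≤ e₂ * x ^ (-1 - m) := inf_le_right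

/-- [folklore] -/
theorem mixedProfile_nonneg {e₁ e₂ : ℝ} (μ m : ℝ) (h₁ : 0 ≤ e₁) (h₂ : 0 ≤ e₂) {x : ℝ} (hx : 0 ≤ x) :
    0 ≤ mixedProfile e₁ e₂ μ m x :=
  le_inf (mul_nonneg h₁ (rpow_nonneg hx _)) (mul_nonneg h₂ (rpow_nonneg hx _))

/-- [folklore] -/
theorem continuousOn_mixedProfile (e₁ e₂ μ m : ℝ) {s : Set ℝ} (hs : ∀ x ∈ s, 0 < x) :
    ContinuousOn (mixedProfile e₁ e₂ μ m) s := by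
  have h1 : ContinuousOn (fun x : ℝ => e₁ * x ^ (-1 + μ)) s :=
    continuousOn_const.mul (continuousOn_id.rpow_const fun x hx => Or.inl (hs x hx).ne')
  have h2 : ContinuousOn (fun x : ℝ => e₂ * x ^ (-1 - m)) s :=
    continuousOn_const.mul (continuousOn_id.rpow_const fun x hx => Or.inl (hs x hx).ne')
  exact h1.inf h2

/-- [folklore] -/
theorem intervalIntegrable_mixedProfile (e₁ e₂ μ m : ℝ) {a b : ℝ} (ha : 0 < a) (hab : a ≤ b) :
    IntervalIntegrable (mixedProfile e₁ e₂ μ m) volume a b := by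
  refine ContinuousOn.intervalIntegrable ?_
  rw [uIcc_of_le hab]
  exact continuousOn_mixedProfile e₁ e₂ μ m fun x hx => ha.trans_le hx.1

/-- [folklore] -/
private theorem intervalIntegrable_constMulRpow (e p : ℝ) {a b : ℝ} (ha : 0 < a) (hab : a ≤ b) :
    IntervalIntegrable (fun x : ℝ => e * x ^ p) volume a b := by
  refine ContinuousOn.intervalIntegrable ?_
  rw [uIcc_of_le hab]
  exact continuousOn_const.mul (continuousOn_id.rpow_const fun x hx => Or.inl (ha.trans_le hx.1).ne')

/-- First input alone on `[a, b]`: `∫_a^b (profile) ≤ e₁ b^μ/μ` — the supercritical input pays the OUTER radius.  [folklore] -/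
theorem integral_le_first {e₁ μ : ℝ} (e₂ m : ℝ) (hμ : 0 < μ) (h₁ : 0 ≤ e₁) {a b : ℝ} (ha : 0 < a) (hab : a ≤ b) :
    ∫ x in a..b, mixedProfile e₁ e₂ μ m x ≤ e₁ * b ^ μ / μ := by
  calc ∫ x in a..b, mixedProfile e₁ e₂ μ m x ≤ ∫ x in a..b, e₁ * x ^ (-1 + μ) :=
        integral_mono_on hab (intervalIntegrable_mixedProfile e₁ e₂ μ m ha hab)
          (intervalIntegrable_constMulRpow e₁ (-1 + μ) ha hab) fun x _ => mixedProfile_le_left _ _ _ _ _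
    _ = e₁ * ((b ^ μ - a ^ μ) / μ) := by
        rw [intervalIntegral.integral_const_mul, integral_rpow (Or.inl (by linarith))]
        rw [show (-1 + μ + 1) = μ by ring]
    _ ≤ e₁ * (b ^ μ / μ) := by
        have ha' : 0 ≤ a ^ μ := rpow_nonneg ha.le _
        exact mul_le_mul_of_nonneg_left (div_le_div_of_nonneg_right (by linarith) hμ.le) h₁
    _ = e₁ * b ^ μ / μ := by ring

/-- Second input alone on `[a, b]`: `∫_a^b (profile) ≤ e₂ a^{−m}/m` — the subcritical input pays the INNER radius
(`SupToFluxExponents.radial_bounded_of_margin_pos`).  [folklore] -/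
theorem integral_le_second (e₁ μ : ℝ) {e₂ m : ℝ} (hm : 0 < m) (h₂ : 0 ≤ e₂) {a b : ℝ} (ha : 0 < a) (hab : a ≤ b) :
    ∫ x in a..b, mixedProfile e₁ e₂ μ m x ≤ e₂ * a ^ (-m) / m := by
  calc ∫ x in a..b, mixedProfile e₁ e₂ μ m x ≤ ∫ x in a..b, e₂ * x ^ (-1 - m) :=
        integral_mono_on hab (intervalIntegrable_mixedProfile e₁ e₂ μ m ha hab)
          (intervalIntegrable_constMulRpow e₂ (-1 - m) ha hab) fun x _ => mixedProfile_le_right _ _ _ _ _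
    _ = e₂ * ∫ x in a..b, x ^ (-1 - m) := intervalIntegral.integral_const_mul _ _
    _ ≤ e₂ * (a ^ (-m) / m) := mul_le_mul_of_nonneg_left (radial_bounded_of_margin_pos hm ha hab) h₂
    _ = e₂ * a ^ (-m) / m := by ring

/-- UPPER BOUND FOR EVERY SPLIT RADIUS `ρ > 0` (whether or not `ρ ∈ [r₀, R]`):
`∫_{r₀}^{R} (profile) ≤ e₁ρ^μ/μ + e₂ρ^{−m}/m`.  [folklore] -/
theorem integral_le_of_split {e₁ e₂ μ m : ℝ} (hμ : 0 < μ) (hm : 0 < m) (h₁ : 0 ≤ e₁) (h₂ : 0 ≤ e₂)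
    {r₀ R ρ : ℝ} (hr₀ : 0 < r₀) (hR : r₀ ≤ R) (hρ : 0 < ρ) :
    ∫ x in r₀..R, mixedProfile e₁ e₂ μ m x ≤ e₁ * ρ ^ μ / μ + e₂ * ρ ^ (-m) / m := by
  have hA : 0 ≤ e₁ * ρ ^ μ / μ := div_nonneg (mul_nonneg h₁ (rpow_nonneg hρ.le _)) hμ.le
  have hB : 0 ≤ e₂ * ρ ^ (-m) / m := div_nonneg (mul_nonneg h₂ (rpow_nonneg hρ.le _)) hm.le
  rcases le_or_gt ρ r₀ with hρr | hρr
  · have h := integral_le_second e₁ μ hm h₂ hr₀ hR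
    have hmono : r₀ ^ (-m) ≤ ρ ^ (-m) := rpow_le_rpow_of_nonpos hρ hρr (by linarith)
    have : e₂ * r₀ ^ (-m) / m ≤ e₂ * ρ ^ (-m) / m :=
      div_le_div_of_nonneg_right (mul_le_mul_of_nonneg_left hmono h₂) hm.le
    linarith
  rcases le_or_gt R ρ with hRρ | hRρ
  · have h := integral_le_first e₂ m hμ h₁ hr₀ hR
    have hmono : R ^ μ ≤ ρ ^ μ := rpow_le_rpow (hr₀.le.trans hR) hRρ hμ.le
    have : e₁ * R ^ μ / μ ≤ e₁ * ρ ^ μ / μ :=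
      div_le_div_of_nonneg_right (mul_le_mul_of_nonneg_left hmono h₁) hμ.le
    linarith
  · have hsplit := integral_add_adjacent_intervals
      (intervalIntegrable_mixedProfile e₁ e₂ μ m hr₀ hρr.le)
      (intervalIntegrable_mixedProfile e₁ e₂ μ m hρ hRρ.le)
    rw [← hsplit]
    exact add_le_add (integral_le_first e₂ m hμ h₁ hr₀ hρr.le) (integral_le_second e₁ μ hm h₂ hρ hRρ.le)

/-- The CROSSOVER condition at `ρ`: the two inputs coincide there, `e₁ρ^{−1+μ} = e₂ρ^{−1−m}`, i.e.
`e₁ρ^μ = e₂ρ^{−m}`.  [folklore] -/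
def Crossing (e₁ e₂ μ m ρ : ℝ) : Prop := e₁ * ρ ^ μ = e₂ * ρ ^ (-m)

/-- At the crossover the upper bound is the crossover value times `(1/μ + 1/m)`.  [folklore] -/
theorem integral_le_at_crossing {e₁ e₂ μ m : ℝ} (hμ : 0 < μ) (hm : 0 < m) (h₁ : 0 ≤ e₁) (h₂ : 0 ≤ e₂)
    {r₀ R ρ : ℝ} (hr₀ : 0 < r₀) (hR : r₀ ≤ R) (hρ : 0 < ρ) (hc : Crossing e₁ e₂ μ m ρ) :
    ∫ x in r₀..R, mixedProfile e₁ e₂ μ m x ≤ e₁ * ρ ^ μ * (1 / μ + 1 / m) := by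
  have h := integral_le_of_split hμ hm h₁ h₂ hr₀ hR hρ
  unfold Crossing at hc
  rw [← hc] at h
  have : e₁ * ρ ^ μ / μ + e₁ * ρ ^ μ / m = e₁ * ρ ^ μ * (1 / μ + 1 / m) := by ring
  linarith

/-- LOWER BOUND: the extremal profile attains half the crossover value as soon as `[ρ/2, ρ] ⊆ [r₀, R]` (for `μ ≤ 1`,
`m ≥ 0`: both inputs are non-increasing in `r`).  So two pointwise inputs alone give exactly the crossover value — no
`ε₀`-independent improvement is hidden in them.  [folklore] -/
theorem integral_ge_at_crossing {e₁ e₂ μ m : ℝ} (hμ1 : μ ≤ 1) (hm : 0 ≤ m) (h₁ : 0 ≤ e₁) (h₂ : 0 ≤ e₂)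
    {r₀ R ρ : ℝ} (hr₀ : 0 < r₀) (hρ : 0 < ρ) (hc : Crossing e₁ e₂ μ m ρ) (h2r : 2 * r₀ ≤ ρ) (hρR : ρ ≤ R) :
    e₁ * ρ ^ μ / 2 ≤ ∫ x in r₀..R, mixedProfile e₁ e₂ μ m x := by
  have hr₀ρ : r₀ ≤ ρ / 2 := by linarith
  have hρ2 : 0 < ρ / 2 := by linarith
  have hR : r₀ ≤ R := by linarith
  have hcross' : e₂ * ρ ^ (-1 - m) = e₁ * ρ ^ (-1 + μ) := by
    have hm1 : ρ ^ (-1 - m) = ρ ^ (-m) * ρ ^ (-1 : ℝ) := by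
      rw [← rpow_add hρ]; congr 1; ring
    have hμ1' : ρ ^ (-1 + μ) = ρ ^ μ * ρ ^ (-1 : ℝ) := by
      rw [← rpow_add hρ]; congr 1; ring
    rw [hm1, hμ1', ← mul_assoc, ← mul_assoc]
    unfold Crossing at hc
    rw [hc]
  have hlow : ∀ x ∈ Icc (ρ / 2) ρ, e₁ * ρ ^ (-1 + μ) ≤ mixedProfile e₁ e₂ μ m x := by
    intro x hx
    have hx0 : 0 < x := hρ2.trans_le hx.1
    refine le_inf ?_ ?_
    · exact mul_le_mul_of_nonneg_left (rpow_le_rpow_of_nonpos hx0 hx.2 (by linarith)) h₁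
    · rw [← hcross']
      exact mul_le_mul_of_nonneg_left (rpow_le_rpow_of_nonpos hx0 hx.2 (by linarith)) h₂
  have hnn : 0 ≤ᵐ[volume.restrict (Ioc r₀ R)] mixedProfile e₁ e₂ μ m :=
    ae_restrict_of_forall_mem measurableSet_Ioc fun x hx =>
      mixedProfile_nonneg μ m h₁ h₂ (hr₀.trans hx.1).le
  have hval : ρ * ρ ^ (-1 + μ) = ρ ^ μ := by
    rw [show (-1 + μ) = μ - 1 by ring, rpow_sub_one hρ.ne']
    field_simp
  calc e₁ * ρ ^ μ / 2 = ∫ _ in (ρ / 2)..ρ, e₁ * ρ ^ (-1 + μ) := by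
        rw [intervalIntegral.integral_const, smul_eq_mul, ← hval]; ring
    _ ≤ ∫ x in (ρ / 2)..ρ, mixedProfile e₁ e₂ μ m x :=
        integral_mono_on (by linarith) intervalIntegrable_const
          (intervalIntegrable_mixedProfile e₁ e₂ μ m hρ2 (by linarith)) hlow
    _ ≤ ∫ x in r₀..R, mixedProfile e₁ e₂ μ m x :=
        integral_mono_interval hr₀ρ (by linarith) hρR hnn (intervalIntegrable_mixedProfile e₁ e₂ μ m hr₀ hR)

/-- The crossover radius `ρ_c = (e₂/e₁)^{1/(μ+m)}`.  [folklore] -/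
def crossover (e₁ e₂ μ m : ℝ) : ℝ := (e₂ / e₁) ^ (μ + m)⁻¹

/-- [folklore] -/
theorem crossover_pos {e₁ e₂ : ℝ} (μ m : ℝ) (h₁ : 0 < e₁) (h₂ : 0 < e₂) : 0 < crossover e₁ e₂ μ m :=
  rpow_pos_of_pos (div_pos h₂ h₁) _

/-- `ρ_c` satisfies the crossover condition.  [folklore] -/
theorem crossing_crossover {e₁ e₂ μ m : ℝ} (h₁ : 0 < e₁) (h₂ : 0 < e₂) (hμm : μ + m ≠ 0) :
    Crossing e₁ e₂ μ m (crossover e₁ e₂ μ m) := by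
  unfold Crossing
  set ρ := crossover e₁ e₂ μ m with hρdef
  have hq : 0 < e₂ / e₁ := div_pos h₂ h₁
  have hρ : 0 < ρ := crossover_pos μ m h₁ h₂
  have hρm : ρ ^ (μ + m) = e₂ / e₁ := by
    rw [hρdef]; unfold crossover; rw [rpow_inv_rpow hq.le hμm]
  have hkey : e₁ * ρ ^ μ * ρ ^ m = e₂ := by
    rw [mul_assoc, ← rpow_add hρ, hρm]; field_simp
  have hm0 : ρ ^ m ≠ 0 := (rpow_pos_of_pos hρ m).ne'
  calc e₁ * ρ ^ μ = e₁ * ρ ^ μ * ρ ^ m * (ρ ^ m)⁻¹ := by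
        rw [mul_assoc (e₁ * ρ ^ μ), mul_inv_cancel₀ hm0, mul_one]
    _ = e₂ * ρ ^ (-m) := by rw [hkey, rpow_neg hρ.le]

/-- The crossover VALUE: `e₁ρ_c^μ = e₁(e₂/e₁)^{μ/(μ+m)}` (`= e₁^{m/(μ+m)}e₂^{μ/(μ+m)}`): a geometric interpolation of the
two amplitudes, strictly between them when `e₁ < e₂` — with `e₁ = ε₀²`, `e₂ = ε²` it is NEVER `≲ ε₀²`.  [folklore] -/
theorem value_crossover {e₁ e₂ : ℝ} (μ m : ℝ) (h₁ : 0 < e₁) (h₂ : 0 < e₂) :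
    e₁ * crossover e₁ e₂ μ m ^ μ = e₁ * (e₂ / e₁) ^ (μ / (μ + m)) := by
  unfold crossover
  rw [← rpow_mul (div_pos h₂ h₁).le]
  have : (μ + m)⁻¹ * μ = μ / (μ + m) := by rw [div_eq_inv_mul]
  rw [this]

/-! ## §2 The `u`-count: the first amplitude decays in `u`, the second does not -/

/-- The `u`-MARGIN `ν = (2mδ_X − μ)/(μ+m)` of the crossover value when `e₁ = ε₀²u^{−1−2δ_X}` (an `ε₀`-size input with
pointwise decay `u^{−1/2−δ_X}`) and `e₂ = ε₁²` (a size-`ε₁` input with no `u`-decay, as in BA-B, KS l.5811–5815).  [folklore] -/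
def uMargin (δX μ m : ℝ) : ℝ := (2 * m * δX - μ) / (μ + m)

/-- Exponent bookkeeping: `u^{−1−2δ_X} · (u^{1+2δ_X})^{μ/(μ+m)} = u^{−1−ν}`.  [folklore] -/
theorem uExponent_eq {δX μ m : ℝ} (hμm : μ + m ≠ 0) :
    (-1 - 2 * δX) + (1 + 2 * δX) * (μ / (μ + m)) = -1 - uMargin δX μ m := by
  unfold uMargin; field_simp; ring

/-- `ν > 0` iff `μ < 2mδ_X`.  [folklore] -/
theorem uMargin_pos_iff {δX μ m : ℝ} (hμm : 0 < μ + m) : 0 < uMargin δX μ m ↔ μ < 2 * m * δX := by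
  unfold uMargin; rw [div_pos_iff_of_pos_right hμm]; constructor <;> intro h <;> linarith

/-- `ν < 0` iff `2mδ_X < μ`.  [folklore] -/
theorem uMargin_neg_iff {δX μ m : ℝ} (hμm : 0 < μ + m) : uMargin δX μ m < 0 ↔ 2 * m * δX < μ := by
  unfold uMargin; rw [div_neg_iff]; constructor
  · rintro (⟨h1, h2⟩ | ⟨h1, h2⟩) <;> [linarith; linarith]
  · intro h; exact Or.inr ⟨by linarith, hμm⟩

/-- The crossover value per unit `u`: with `e₁(u) = ε₀² u^{−1−2δ_X}`, `e₂ = ε₁²`,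
`e₁(u)·(e₂/e₁(u))^{μ/(μ+m)} = ε₀²(ε₁²/ε₀²)^{μ/(μ+m)} · u^{−1−ν}`.  [folklore] -/
theorem value_u {ε₀ ε₁ δX μ m u : ℝ} (h0 : 0 < ε₀) (h1 : 0 < ε₁) (hu : 0 < u) (hμm : μ + m ≠ 0) :
    (ε₀ ^ 2 * u ^ (-1 - 2 * δX)) * (ε₁ ^ 2 / (ε₀ ^ 2 * u ^ (-1 - 2 * δX))) ^ (μ / (μ + m))
      = (ε₀ ^ 2 * (ε₁ ^ 2 / ε₀ ^ 2) ^ (μ / (μ + m))) * u ^ (-1 - uMargin δX μ m) := by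
  set θ := μ / (μ + m) with hθ
  have hU : 0 < u ^ (-1 - 2 * δX) := rpow_pos_of_pos hu _
  have hq0 : 0 ≤ ε₁ ^ 2 / ε₀ ^ 2 := by positivity
  have hinv : (u ^ (-1 - 2 * δX))⁻¹ = u ^ (1 + 2 * δX) := by
    rw [← rpow_neg hu.le]; congr 1; ring
  have hq : ε₁ ^ 2 / (ε₀ ^ 2 * u ^ (-1 - 2 * δX)) = (ε₁ ^ 2 / ε₀ ^ 2) * u ^ (1 + 2 * δX) := by
    rw [← hinv]; field_simp
  rw [hq, mul_rpow hq0 (rpow_nonneg hu.le _), ← rpow_mul hu.le]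
  have hexp : u ^ (-1 - 2 * δX) * u ^ ((1 + 2 * δX) * θ) = u ^ (-1 - uMargin δX μ m) := by
    rw [← rpow_add hu, hθ, uExponent_eq hμm]
  calc ε₀ ^ 2 * u ^ (-1 - 2 * δX) * ((ε₁ ^ 2 / ε₀ ^ 2) ^ θ * u ^ ((1 + 2 * δX) * θ))
        = ε₀ ^ 2 * (ε₁ ^ 2 / ε₀ ^ 2) ^ θ * (u ^ (-1 - 2 * δX) * u ^ ((1 + 2 * δX) * θ)) := by ring
    _ = ε₀ ^ 2 * (ε₁ ^ 2 / ε₀ ^ 2) ^ θ * u ^ (-1 - uMargin δX μ m) := by rw [hexp]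

/-- Positive `u`-margin: `∫_1^U u^{−1−ν} du ≤ 1/ν` uniformly in `U ≥ 1`.  [folklore] -/
theorem uIntegral_bounded {ν U : ℝ} (hν : 0 < ν) (hU : 1 ≤ U) : ∫ u in (1 : ℝ)..U, u ^ (-1 - ν) ≤ 1 / ν := by
  have h := radial_bounded_of_margin_pos hν one_pos hU
  simpa [one_rpow] using h

/-- Negative `u`-margin: `∫_1^U u^{−1−ν} du → ∞` — the mixed count then grows like `U^{−ν}/(−ν)` in the bootstrap time and gives
no `U`-uniform improvement.  [folklore] -/
theorem uIntegral_unbounded {ν : ℝ} (hν : ν < 0) :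
    Tendsto (fun U : ℝ => ∫ u in (1 : ℝ)..U, u ^ (-1 - ν)) atTop atTop := by
  have h := radial_unbounded_of_margin_neg (δ := -ν) (r₀ := 1) (by linarith) one_pos
  simpa [sub_eq_add_neg] using h

/-- Zero `u`-margin: `∫_1^U u^{−1} du = log U` (→ ∞, `Real.tendsto_log_atTop`).  [folklore] -/
theorem uIntegral_critical {U : ℝ} (hU : 0 < U) : ∫ u in (1 : ℝ)..U, u ^ (-1 - (0 : ℝ)) = Real.log U := by
  simp only [sub_zero, rpow_neg_one]
  rw [integral_inv_of_pos one_pos hU, div_one]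

/-! ## §3 The KS instance: `m = 1`, `δ_X = δ_dec`, `μ = δ_B + δ_dec − δ_extra`; the mixing window -/

/-- BA-B's rate `7/2 + δ_B/2` (KS l.5811–5815) has margin exactly `1` against the weight `r^{3+δ_B}` of `^(ext)ℜ_k` (l.23912–23915).
[cite: KlainermanSzeftel2021, eq. l.5811–5815 (ext𝔅_k) vs §9.4.1 l.23912–23915, TeX] -/
theorem marginAB_bounded (δB : ℝ) : margin (wAB δB) (rateAB_bounded δB) = 1 := by
  unfold margin wAB rateAB_bounded; ring

/-- The CRITICAL rate for the `(A, B)` weight is `3 + δ_B/2` (margin `0`): an `ε₀`-size pointwise input helps the `ε₀`-count iff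
its rate exceeds it.  [cite: KlainermanSzeftel2021, §9.4.1, TeX l.23912–23915] -/
theorem marginAB_critical (δB : ℝ) : margin (wAB δB) (3 + δB / 2) = 0 := by
  unfold margin wAB; ring

/-- `μ := −margin` of KS Proposition l.16631–16637's rate `3 + δ′` for `B` (`δ′ = (δ_extra − δ_dec)/2`).
[cite: KlainermanSzeftel2021, Proposition (TeX l.16631–16637) vs §9.4.1 l.23912–23915] -/
def mu (δB δextra δdec : ℝ) : ℝ := -margin (wAB δB) (rateB_improved δextra δdec)

/-- `μ = δ_B + δ_dec − δ_extra`.  [cite: KlainermanSzeftel2021, Proposition (TeX l.16631–16637); (9.4.35)] -/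
theorem mu_eq (δB δextra δdec : ℝ) : mu δB δextra δdec = δB + δdec - δextra := by
  unfold mu; rw [marginB_improved]; ring

/-- At GKS's printed `δ_extra = (3δ_h − 2δ)/2` (`δ_h ≤ δ_dec`), under KS (3.4.4) `δ_B > 2δ_dec`: `μ > (3/2)δ_dec + δ > 0` — the
`ε₀`-size input (I₀) alone is supercritical (tree `marginB_GKS_neg`).
[cite: KlainermanSzeftel2021, (3.4.4) TeX l.6076–6080; GiorgiKlainermanSzeftel2022, TeX l.22524 (printed p.532)] -/
theorem mu_GKS_lower {δB δdec δ δh : ℝ} (hdec : 0 ≤ δdec) (h344 : 2 * δdec < δB) (hδ : 0 ≤ δ) (hh : δh ≤ δdec) :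
    (3 / 2) * δdec + δ < mu δB (deltaExtraGKS δh δ) δdec ∧ 0 < mu δB (deltaExtraGKS δh δ) δdec := by
  have h := marginB_GKS_neg hdec h344 hδ hh
  unfold mu
  constructor <;> linarith [h.1, h.2]

/-- THE MIXING WINDOW (upper end).  With `m = 1` (BA-B, `marginAB_bounded`) and `δ_X = δ_dec` (the `u`-decay of KS Proposition
l.16631–16637), the `u`-margin of the mixed count is positive iff `δ_B < δ_dec + δ_extra`.
[cite: KlainermanSzeftel2021, Proposition (TeX l.16631–16637), eq. l.5811–5815, §9.4.1 l.23912–23915] -/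
theorem mixingWindow_iff {δB δextra δdec : ℝ} (hμ : 0 < mu δB δextra δdec + 1) :
    0 < uMargin δdec (mu δB δextra δdec) 1 ↔ δB < δdec + δextra := by
  rw [uMargin_pos_iff hμ, mu_eq]; constructor <;> intro h <;> linarith

/-- … and negative iff `δ_dec + δ_extra < δ_B` (then `uIntegral_unbounded`: no `u_*`-uniform improvement from (I₀)+(I_ε)).
[cite: KlainermanSzeftel2021, Proposition (TeX l.16631–16637), eq. l.5811–5815] -/
theorem mixingWindow_fails_iff {δB δextra δdec : ℝ} (hμ : 0 < mu δB δextra δdec + 1) :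
    uMargin δdec (mu δB δextra δdec) 1 < 0 ↔ δdec + δextra < δB := by
  rw [uMargin_neg_iff hμ, mu_eq]; constructor <;> intro h <;> linarith

/-- At GKS's value with `δ_h = δ_dec` the window's upper end is `(5/2)δ_dec − δ`.
[cite: GiorgiKlainermanSzeftel2022, Theorem M1 ch. 11 Step 7, TeX l.22524 (printed p.532, PDF p.533)] -/
theorem mixingWindow_GKS (δB δdec δ : ℝ) :
    δB < δdec + deltaExtraGKS δdec δ ↔ δB < 5 / 2 * δdec - δ := by
  unfold deltaExtraGKS; constructor <;> intro h <;> linarith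

/-- The window `2δ_dec < δ_B < δ_dec + δ_extra` (lower end = KS (3.4.4), l.6076–6080) is NONEMPTY iff `δ_dec < δ_extra` — printed by
KS as a consequence of Theorem M1 (l.6672, "there exists `δ_extra > δ_dec`"); at GKS's value this is `δ < δ_dec/2` strictly.
[cite: KlainermanSzeftel2021, (3.4.4) TeX l.6076–6080 and Theorem M1 l.6672] -/
theorem mixingWindow_nonempty_iff (δdec δextra : ℝ) :
    (∃ δB, 2 * δdec < δB ∧ δB < δdec + δextra) ↔ δdec < δextra := by
  constructor
  · rintro ⟨δB, h1, h2⟩; linarith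
  · intro h; exact ⟨(3 * δdec + δextra) / 2, by linarith, by linarith⟩

/-- [cite: GiorgiKlainermanSzeftel2022, Theorem M1 ch. 11 Step 7, TeX l.22524] -/
theorem deltaExtraGKS_gt_iff (δdec δ : ℝ) : δdec < deltaExtraGKS δdec δ ↔ 2 * δ < δdec := by
  unfold deltaExtraGKS; constructor <;> intro h <;> linarith

/-- UNDECIDED BY PRINT.  KS (3.4.4) prints only `δ_B > 2δ_dec`; with GKS's `δ_extra` (`δ_h = δ_dec`, `2δ < δ_dec`) there are
admissible parameter points INSIDE the mixing window and points OUTSIDE it that are still inside the `A`-window `δ_B < 2δ_extra`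
(`δ_dec = 1/100`, `δ = 1/400`: `δ_extra = 1/80`, mixing window `(1/50, 9/400)`, `A`-window `(1/50, 1/40)`; `δ_B = 17/800` resp.
`19/800`).  [cite: KlainermanSzeftel2021, (3.4.4) TeX l.6076–6080; GiorgiKlainermanSzeftel2022, TeX l.22524] -/
theorem mixingWindow_undecided :
    (∃ δB δdec δ : ℝ, 0 < δdec ∧ 0 ≤ δ ∧ 2 * δ < δdec ∧ 2 * δdec < δB ∧ δB < 2 * deltaExtraGKS δdec δ ∧
        δB < δdec + deltaExtraGKS δdec δ) ∧
    (∃ δB δdec δ : ℝ, 0 < δdec ∧ 0 ≤ δ ∧ 2 * δ < δdec ∧ 2 * δdec < δB ∧ δB < 2 * deltaExtraGKS δdec δ ∧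
        δdec + deltaExtraGKS δdec δ < δB) := by
  refine ⟨⟨17 / 800, 1 / 100, 1 / 400, ?_⟩, ⟨19 / 800, 1 / 100, 1 / 400, ?_⟩⟩ <;> unfold deltaExtraGKS <;> norm_num

/-- The LOSS EXPONENT `κ = μ/(3(1+μ))` of the mixed count at `ε₁ = ε = ε₀^{2/3}` (KS (3.4.4), l.6089–6091), `m = 1`:
`ε₀²(ε²/ε₀²)^{μ/(μ+1)} = ε₀^{2−2κ}`.  [cite: KlainermanSzeftel2021, eq. (3.4.4) `ε = ε₀^{2/3}`, TeX l.6089–6091] -/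
def kappa (μ : ℝ) : ℝ := μ / (3 * (1 + μ))

/-- [folklore] -/
theorem kappa_pos {μ : ℝ} (hμ : 0 < μ) : 0 < kappa μ := by unfold kappa; positivity

/-- `κ < 1/3` always (`μ > 0`): the mixed scale `ε₀^{1−κ}` is strictly between `ε₀` and `ε = ε₀^{2/3}`.  [folklore] -/
theorem kappa_lt_third {μ : ℝ} (hμ : 0 < μ) : kappa μ < 1 / 3 := by
  unfold kappa
  rw [div_lt_iff₀ (by positivity)]
  linarith

/-- `1/3 − κ = 1/(3(1+μ))`.  [folklore] -/
theorem third_sub_kappa {μ : ℝ} (hμ : 0 < μ) : 1 / 3 - kappa μ = 1 / (3 * (1 + μ)) := by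
  have hne : (3 : ℝ) * (1 + μ) ≠ 0 := by positivity
  unfold kappa; field_simp; ring

/-- The scale identity: `ε₀² · (ε²/ε₀²)^{μ/(μ+1)} = ε₀^{2−2κ}` for `ε = ε₀^{2/3}`.
[cite: KlainermanSzeftel2021, eq. (3.4.4) `ε = ε₀^{2/3}`, TeX l.6089–6091] -/
theorem scale_identity {ε₀ μ : ℝ} (h0 : 0 < ε₀) (hμ : 0 < μ) :
    ε₀ ^ 2 * ((ε₀ ^ ((2 : ℝ) / 3)) ^ 2 / ε₀ ^ 2) ^ (μ / (μ + 1)) = ε₀ ^ (2 - 2 * kappa μ) := by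
  have hne : μ + 1 ≠ 0 := by positivity
  have hne3 : (3 : ℝ) * (1 + μ) ≠ 0 := by positivity
  simp only [← rpow_two]
  have h1 : (ε₀ ^ ((2 : ℝ) / 3)) ^ (2 : ℝ) / ε₀ ^ (2 : ℝ) = ε₀ ^ (-(2 : ℝ) / 3) := by
    rw [← rpow_mul h0.le, ← rpow_sub h0]; norm_num
  rw [h1, ← rpow_mul h0.le, ← rpow_add h0]
  congr 1
  unfold kappa; field_simp; ring

/-- With `0 < ε₀ < 1` and `0 < κ < 1/3`: `ε₀ < ε₀^{1−κ} < ε₀^{2/3}` — the mixed base is a genuine improvement over BA-PT's `ε` and a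
genuine loss against (9.4.22)'s `ε₀`.  [cite: KlainermanSzeftel2021, eq. (3.4.4), TeX l.6089–6091; Lemma 9.4.13 l.24355–24360] -/
theorem mixedScale_between {ε₀ κ : ℝ} (h0 : 0 < ε₀) (h1 : ε₀ < 1) (hκ : 0 < κ) (hκ3 : κ < 1 / 3) :
    ε₀ < ε₀ ^ (1 - κ) ∧ ε₀ ^ (1 - κ) < ε₀ ^ ((2 : ℝ) / 3) := by
  constructor
  · have : ε₀ ^ (1 : ℝ) < ε₀ ^ (1 - κ) := rpow_lt_rpow_of_exponent_gt h0 h1 (by linarith)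
    simpa using this
  · exact rpow_lt_rpow_of_exponent_gt h0 h1 (by linarith)

/-! ## §4 What the continuation argument tolerates: Theorem M8 at `C·ε₀^{1−κ}` still re-enters `ℵ(u_*′)` -/

/-- If `κ < 1/3` then `C ε₀^{1−κ} ≤ ε₀^{2/3}/2` for `ε₀ ≤ (2C)^{−1/(1/3−κ)}`: an improved bound at the mixed scale is still below
half the bootstrap size `ε = ε₀^{2/3}` (cf. `Bootstrap.eps_arith`, the case `κ = 0`).  [folklore] -/
theorem weakM8_tolerated {κ C ε₀ : ℝ} (hκ : κ < 1 / 3) (hC : 0 < C) (h0 : 0 < ε₀)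
    (hsmall : ε₀ ≤ ((2 * C)⁻¹) ^ (1 / 3 - κ)⁻¹) : C * ε₀ ^ (1 - κ) ≤ ε₀ ^ ((2 : ℝ) / 3) / 2 := by
  set σ := 1 / 3 - κ with hσ
  have hσpos : 0 < σ := by rw [hσ]; linarith
  have h2C : 0 < (2 * C)⁻¹ := by positivity
  have hpow : ε₀ ^ σ ≤ (2 * C)⁻¹ := by
    calc ε₀ ^ σ ≤ (((2 * C)⁻¹) ^ σ⁻¹) ^ σ := rpow_le_rpow h0.le hsmall hσpos.le
      _ = (2 * C)⁻¹ := rpow_inv_rpow h2C.le hσpos.ne'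
  have hsplit : ε₀ ^ (1 - κ) = ε₀ ^ σ * ε₀ ^ ((2 : ℝ) / 3) := by
    rw [← rpow_add h0]; congr 1; rw [hσ]; ring
  rw [hsplit]
  have h23 : 0 < ε₀ ^ ((2 : ℝ) / 3) := rpow_pos_of_pos h0 _
  have hCC : C * (2 * C)⁻¹ = 1 / 2 := by field_simp
  calc C * (ε₀ ^ σ * ε₀ ^ ((2 : ℝ) / 3)) = (C * ε₀ ^ σ) * ε₀ ^ ((2 : ℝ) / 3) := by ring
    _ ≤ (C * (2 * C)⁻¹) * ε₀ ^ ((2 : ℝ) / 3) := by gcongr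
    _ = ε₀ ^ ((2 : ℝ) / 3) / 2 := by rw [hCC]; ring

/-- THE TYPED TOLERANCE.  The cell's continuation-argument certificate `Bootstrap.Uset_not_bddAbove` consumes the smallness of `ε₀`
only through `Bootstrap.SmallEps K c` = `(cM8 + cM7)ε₀ ≤ ε ∧ cM7 ε₀ ≤ ε`.  If Theorem M8 delivers `𝔑^{(Sup)}_{k_large} ≤ C ε₀^{1−κ}`
instead of `≤ cM8 ε₀` — i.e. the constants record with `cM8 := C ε₀^{−κ}` — then `SmallEps` STILL HOLDS for `ε₀` below two explicit
thresholds, because `κ < 1/3` (`weakM8_tolerated`, `Bootstrap.eps_arith`).  So a mixed-scale iteration base costs nothing in the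
continuation argument; the cost is confined to the Main Theorem's conclusion (3.4.8), whose clause `𝔑^{(Sup)}_{k_large} ≲ ε₀` becomes
`≲ ε₀^{1−κ}`.  [cite: KlainermanSzeftel2021, §3.7.2 continuation argument with (3.4.4), TeX l.6089–6091, l.6778–6813; Main Theorem (3.4.8) l.6217–6220] -/
theorem smallEps_of_weakM8 (K : Bootstrap.LesConstants) (c : Bootstrap.Constants) (hc : c.Admissible)
    {C κ : ℝ} (hκ : κ < 1 / 3) (hC : 0 < C) (h7 : 0 < K.cM7)
    (hs1 : c.ε0 ≤ ((2 * C)⁻¹) ^ (1 / 3 - κ)⁻¹) (hs2 : c.ε0 ≤ ((2 * K.cM7)⁻¹) ^ (3 : ℕ)) :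
    Bootstrap.SmallEps { K with cM8 := C * c.ε0 ^ (-κ) } c := by
  have h0 := hc.ε0_pos
  have hA : C * c.ε0 ^ (-κ) * c.ε0 = C * c.ε0 ^ (1 - κ) := by
    rw [mul_assoc, show (1 - κ) = -κ + 1 by ring, rpow_add h0, rpow_one]
  have hM8 : C * c.ε0 ^ (1 - κ) ≤ c.ε0 ^ ((2 : ℝ) / 3) / 2 := weakM8_tolerated hκ hC h0 hs1
  have hM7 : 2 * K.cM7 * c.ε0 ≤ c.ε0 ^ ((2 : ℝ) / 3) := Bootstrap.eps_arith _ _ (by positivity) h0 hs2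
  have h70 : 0 ≤ K.cM7 * c.ε0 := mul_nonneg h7.le h0.le
  refine ⟨?_, ?_⟩
  · show (C * c.ε0 ^ (-κ) + K.cM7) * c.ε0 ≤ c.ε
    rw [hc.ε_eq, add_mul, hA]
    linarith
  · show K.cM7 * c.ε0 ≤ c.ε
    rw [hc.ε_eq]
    linarith

end Literature.Geometry.Lorentzian.KlainermanSzeftel2021.MixedRateCount
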